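import Literature.AlgebraicGeometry.GroupSchemes.CartierDualBidual
import Literature.AlgebraicGeometry.GroupSchemes.CartierDualAnnihilatorRank
import HarnessLib

/-!
# Naturality of Cartier biduality: `(f^D)^D ≫ ((G₂^D)^D ≅ G₂) = ((G₁^D)^D ≅ G₁) ≫ f`

Layer `Literature/AlgebraicGeometry/GroupSchemes`, namespace `Literature.AlgebraicGeometry.GroupSchemes.AffineGroupScheme` (continues ★
`CartierDualBidual` p845413 — `cartierDualBidualIso G : (G^D)^D ≅ G`, `bidualAlgEquiv` (the evaluation pairing) —, ★ `CartierDualMap` p845343 —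
`cartierDualMap f = f^D`, `DualAlg.transpose` — and ★ `CartierDualAnnihilatorRank` p845797 §3 — `algCartierDualEquiv_comp_comap_cartierDualMap :
e_G ∘ Γ(j^D) = (Γ(j))^* ∘ e_H`).  THEOREMS ONLY (no definition, no instance, no notation, no named fact, no `sorry`).  Cell `hodgecm-mathlib` (D-0151),
programme P6 «MOD», organ (N1) of B-p04 (g37): the input of the double annihilator `(H^⊥)^⊥ = H` ((g3-c), A-p17 (g25)) and of the base change of
`C^⊥` (A-p06 (g30) ★ `CartierDualAnnihilatorOfDuality`: «needs naturality of the bidual»).  Count-neutral Mathlib-side capital: HC_CM is proved only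
modulo the printed citations until rung 0 closes; nothing here bears on it.

THE PRINT ([Tate1997FiniteFlatGroupSchemes] §(3.8) p. 145: «the canonical map `G → (G^D)^D` is an isomorphism» — canonical = natural in `G`).  For a
homomorphism `f : G₁ ⟶ G₂` (`IsMonHom f`) of finite free commutative affine group objects of `SchemeOver R`:

* §1 `isoSpecOver_hom_naturality : f ≫ (W₂ ≅ Spec Γ(W₂)).hom = (W₁ ≅ Spec Γ(W₁)).hom ≫ Spec Γ(f)` and its `inv` form (Mathlib
  `Scheme.isoSpec_hom_naturality`, in `Over (Spec R)`), for any affine `R`-schemes;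
* §2 `transpose_cartierDualMap_comp_bidualAlgEquiv : (Γ(f^D))^* ∘ Φ_{G₂} = Φ_{G₁} ∘ Γ(f)` — the evaluation isomorphisms `Φ_G : Γ(G) ≃ Γ(G^D)^*`
  (★ `bidualAlgEquiv`) are natural (★ `transpose_apply_apply`, ★ `algCartierDualEquiv_comp_comap_cartierDualMap`);
* §3 HEAD **`cartierDualMap_cartierDualMap_comp_cartierDualBidualIso_hom : (f^D)^D ≫ ε_{G₂}.hom = ε_{G₁}.hom ≫ f`** and
  **`cartierDualBidualIso_inv_comp_cartierDualMap_cartierDualMap : ε_{G₁}.inv ≫ (f^D)^D = f ≫ ε_{G₂}.inv`** (`ε_G :=` ★ `cartierDualBidualIso G`) —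
  `G ↦ ((G^D)^D ≅ G)` IS A NATURAL ISOMORPHISM;
* §4 (ED. 2) `DualAlg.transpose_apply_of_eq_one`, **`cartierDualMap_of_eq_one : f = 1 → f^D = 1`** (the dual of the trivial homomorphism).

## References
* [Tate1997FiniteFlatGroupSchemes] J. Tate, *Finite flat group schemes*, in: Modular Forms and Fermat's Last Theorem (1997), §(3.8) p. 145.
* [GortzWedhorn2023] U. Görtz, T. Wedhorn, *Algebraic Geometry II* (2023), §(27.2) (p. 606).
-/

set_option autoImplicit false

-- Mathlib's `Over`/`Scheme` APIs are stated across semireducible wrappers (as in the ★ `GroupSchemes/*` files).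
set_option backward.isDefEq.respectTransparency false

universe u

open CategoryTheory CategoryTheory.Limits AlgebraicGeometry MonoidalCategory CartesianMonoidalCategory WithConv

noncomputable section

namespace Literature.AlgebraicGeometry.GroupSchemes

namespace AffineGroupScheme

open scoped MonObj

open Literature.AlgebraicGeometry.Motives Literature.NumberTheory.DiophantineGeometry Literature.RingTheory.HopfAlgebra

variable {R : Type u} [CommRing R]

/-! ## §1 `W ≅ Spec Γ(W)` is natural in the affine `R`-scheme `W` -/

section IsoSpec

variable {W₁ W₂ : SchemeOver R} [IsAffine W₁.left] [IsAffine W₂.left] (f : W₁ ⟶ W₂)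

/-- **Naturality of `W ≅ Spec Γ(W, 𝒪_W)` over `R`**: `f ≫ (W₂ ≅ Spec Γ(W₂)) = (W₁ ≅ Spec Γ(W₁)) ≫ Spec Γ(f)` (Mathlib `Scheme.isoSpec_hom_naturality`).
[cite: GortzWedhorn2023, §(27.2) (p. 606)] -/
theorem isoSpecOver_hom_naturality : f ≫ (isoSpecOver W₂).hom = (isoSpecOver W₁).hom ≫ AlgPoints.specOverMapOfAlgHom (Alg.comap f) := by
  apply Over.OverMorphism.ext
  rw [Over.comp_left, Over.comp_left, isoSpecOver_hom_left, isoSpecOver_hom_left, AlgPoints.specOverMapOfAlgHom_left]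
  exact (Scheme.isoSpec_hom_naturality f.left).symm

/-- The same with the inverses: `(Spec Γ(W₁) ≅ W₁) ≫ f = Spec Γ(f) ≫ (Spec Γ(W₂) ≅ W₂)`. [cite: GortzWedhorn2023, §(27.2) (p. 606)] -/
theorem isoSpecOver_inv_comp : (isoSpecOver W₁).inv ≫ f = AlgPoints.specOverMapOfAlgHom (Alg.comap f) ≫ (isoSpecOver W₂).inv := by
  rw [Iso.inv_comp_eq, ← Category.assoc, ← isoSpecOver_hom_naturality, Category.assoc, Iso.hom_inv_id, Category.comp_id]

end IsoSpec

/-! ## §2 The evaluation isomorphisms `Φ_G : Γ(G) ≃ Γ(G^D)^*` are natural -/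

section Bidual

variable {G₁ G₂ : SchemeOver R}
  [GrpObj G₁] [IsCommMonObj G₁] [IsAffine G₁.left] [Module.Free R (Alg G₁)] [Module.Finite R (Alg G₁)]
  [GrpObj G₂] [IsCommMonObj G₂] [IsAffine G₂.left] [Module.Free R (Alg G₂)] [Module.Finite R (Alg G₂)] (f : G₁ ⟶ G₂) [IsMonHom f]

/-- `Spec` of a composite of `R`-algebra maps (a local copy of the private ★ `specOverMapOfAlgHom_comp'`). [cite: GortzWedhorn2023, §(27.2) (p. 606)] -/
private theorem specOverMapOfAlgHom_comp'' {H₁ H₂ H₃ : Type u} [CommRing H₁] [Algebra R H₁] [CommRing H₂] [Algebra R H₂] [CommRing H₃]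
    [Algebra R H₃] (ψ₁ : H₁ →ₐ[R] H₂) (ψ₂ : H₂ →ₐ[R] H₃) :
    AlgPoints.specOverMapOfAlgHom ψ₂ ≫ AlgPoints.specOverMapOfAlgHom ψ₁ = AlgPoints.specOverMapOfAlgHom (ψ₂.comp ψ₁) := by
  apply Over.OverMorphism.ext
  rw [Over.comp_left, AlgPoints.specOverMapOfAlgHom_left, AlgPoints.specOverMapOfAlgHom_left, AlgPoints.specOverMapOfAlgHom_left]
  exact (Spec.map_comp (CommRingCat.ofHom ψ₁.toRingHom) (CommRingCat.ofHom ψ₂.toRingHom)).symm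

/-- **`(Γ(f^D))^* ∘ Φ_{G₂} = Φ_{G₁} ∘ Γ(f)`**: for `a ∈ Γ(G₂)` and `y ∈ Γ(G₁^D)`, both sides pair to `⟨e_{G₁} y, f^*(a)⟩` (★ `bidualAlgEquiv_apply_apply`,
★ `transpose_apply_apply`, ★ `algCartierDualEquiv_comp_comap_cartierDualMap`). [cite: Tate1997FiniteFlatGroupSchemes, §(3.8) p. 145] -/
theorem transpose_cartierDualMap_comp_bidualAlgEquiv :
    (DualAlg.transpose (cartierDualMap f)).comp
        ((bidualAlgEquiv G₂ : Alg G₂ →ₐc[R] DualAlg (cartierDual G₂)) : Alg G₂ →ₐ[R] DualAlg (cartierDual G₂)) =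
      ((bidualAlgEquiv G₁ : Alg G₁ →ₐc[R] DualAlg (cartierDual G₁)) : Alg G₁ →ₐ[R] DualAlg (cartierDual G₁)).comp (Alg.comap f) := by
  apply AlgHom.ext
  intro a
  apply WithConv.ofConv_injective
  apply LinearMap.ext
  intro y
  change WithConv.ofConv (DualAlg.transpose (cartierDualMap f) (bidualAlgEquiv G₂ a)) y = WithConv.ofConv (bidualAlgEquiv G₁ (Alg.comap f a)) y
  rw [DualAlg.transpose_apply_apply, bidualAlgEquiv_apply_apply, bidualAlgEquiv_apply_apply]
  have h := AlgHom.congr_fun (algCartierDualEquiv_comp_comap_cartierDualMap f) y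
  change algCartierDualEquiv G₂ (Alg.comap (cartierDualMap f) y) = DualAlg.transpose f (algCartierDualEquiv G₁ y) at h
  rw [h, DualAlg.transpose_apply_apply]

/-! ## §3 HEAD: `(G^D)^D ≅ G` is natural in `G` -/

/-- `Spec Φ` is natural: `(f^D)^D ≫ Spec Φ_{G₂} = Spec Φ_{G₁} ≫ Spec Γ(f)`. [cite: Tate1997FiniteFlatGroupSchemes, §(3.8) p. 145] -/
theorem cartierDualMap_cartierDualMap_comp_bidualSpecHom :
    cartierDualMap (cartierDualMap f) ≫ bidualSpecHom G₂ = bidualSpecHom G₁ ≫ AlgPoints.specOverMapOfAlgHom (Alg.comap f) := by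
  change AlgPoints.specOverMapOfAlgHom (DualAlg.transpose (cartierDualMap f)) ≫ AlgPoints.specOverMapOfAlgHom _ =
    AlgPoints.specOverMapOfAlgHom _ ≫ AlgPoints.specOverMapOfAlgHom (Alg.comap f)
  rw [specOverMapOfAlgHom_comp'', specOverMapOfAlgHom_comp'', transpose_cartierDualMap_comp_bidualAlgEquiv]

/-- **HEAD — NATURALITY OF CARTIER BIDUALITY: `(f^D)^D ≫ ε_{G₂} = ε_{G₁} ≫ f`** for `ε_G : (G^D)^D ≅ G` (★ `cartierDualBidualIso`):
[Tate1997FiniteFlatGroupSchemes] §(3.8) «the CANONICAL map `G → (G^D)^D` is an isomorphism».  [cite: Tate1997FiniteFlatGroupSchemes, §(3.8) p. 145] -/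
theorem cartierDualMap_cartierDualMap_comp_cartierDualBidualIso_hom :
    cartierDualMap (cartierDualMap f) ≫ (cartierDualBidualIso G₂).hom = (cartierDualBidualIso G₁).hom ≫ f := by
  rw [cartierDualBidualIso_hom, cartierDualBidualIso_hom, ← Category.assoc, cartierDualMap_cartierDualMap_comp_bidualSpecHom, Category.assoc,
    Category.assoc, isoSpecOver_inv_comp]

/-- The same square on the inverses: `ε_{G₁}⁻¹ ≫ (f^D)^D = f ≫ ε_{G₂}⁻¹`. [cite: Tate1997FiniteFlatGroupSchemes, §(3.8) p. 145] -/
theorem cartierDualBidualIso_inv_comp_cartierDualMap_cartierDualMap :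
    (cartierDualBidualIso G₁).inv ≫ cartierDualMap (cartierDualMap f) = f ≫ (cartierDualBidualIso G₂).inv := by
  rw [Iso.inv_comp_eq, ← Category.assoc, ← cartierDualMap_cartierDualMap_comp_cartierDualBidualIso_hom, Category.assoc, Iso.hom_inv_id,
    Category.comp_id]

/-- `f` recovered from its double dual: `f = ε_{G₁}⁻¹ ≫ (f^D)^D ≫ ε_{G₂}`. [cite: Tate1997FiniteFlatGroupSchemes, §(3.8) p. 145] -/
theorem eq_cartierDualBidualIso_inv_comp_comp_hom :
    f = (cartierDualBidualIso G₁).inv ≫ cartierDualMap (cartierDualMap f) ≫ (cartierDualBidualIso G₂).hom := by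
  rw [cartierDualMap_cartierDualMap_comp_cartierDualBidualIso_hom, Iso.inv_hom_id_assoc]

/-- **`f ↦ f^D` is injective on homomorphisms** (faithfulness of the Cartier dual): `f^D = g^D ⟹ f = g`. [cite: Tate1997FiniteFlatGroupSchemes, §(3.8) p. 145] -/
theorem cartierDualMap_injective (g : G₁ ⟶ G₂) [IsMonHom g] (h : cartierDualMap f = cartierDualMap g) : f = g := by
  have hdd : cartierDualMap (cartierDualMap f) = cartierDualMap (cartierDualMap g) := by simp only [h]
  rw [eq_cartierDualBidualIso_inv_comp_comp_hom f, eq_cartierDualBidualIso_inv_comp_comp_hom g, hdd]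

end Bidual

/-! ## §4 (ED. 2) The dual of the trivial homomorphism is trivial: `1^D = 1` -/

section One

variable {G₁ G₂ : SchemeOver R}
  [GrpObj G₁] [IsCommMonObj G₁] [IsAffine G₁.left] [Module.Free R (Alg G₁)] [Module.Finite R (Alg G₁)]
  [GrpObj G₂] [IsCommMonObj G₂] [IsAffine G₂.left] (f : G₁ ⟶ G₂) [IsMonHom f]

omit [Module.Free R (Alg G₁)] [Module.Finite R (Alg G₁)] in
/-- **The transpose of the trivial homomorphism is the trivial character**: if `f = 1` then `(Γ(f))^* μ = μ(1) · 1` in `Γ(G₂)^*`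
(`Γ(1) = η ∘ ε`, ★ `comap_one_hom`; the unit of `Γ(G₂)^*` is `ε`; the bound linear form is written `ν`, `μ` being taken by `MonObj` notation). [cite: Tate1997FiniteFlatGroupSchemes, §(3.8) p. 145] -/
theorem DualAlg.transpose_apply_of_eq_one (hf : f = 1) (ν : DualAlg G₁) :
    DualAlg.transpose f ν = algebraMap R (DualAlg G₂) (WithConv.ofConv ν 1) := by
  apply WithConv.ofConv_injective
  apply LinearMap.ext
  intro a
  rw [DualAlg.transpose_apply_apply, hf, comap_one_hom, AlgHom.comp_apply, Algebra.ofId_apply, Algebra.algebraMap_eq_smul_one,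
    map_smul, Algebra.algebraMap_eq_smul_one, WithConv.ofConv_smul, LinearMap.smul_apply, smul_eq_mul, smul_eq_mul, mul_comm]
  rfl

/-- **`1^D = 1`: the Cartier dual of the trivial homomorphism is the trivial homomorphism** (asked by A-p06 (g30) for the double
annihilator (g3-c): with ★ `annihilatorι_comp`, `(ι ≫ j^D)^D = 1^D = 1`).  Stated for any `f` with `f = 1`, so that the `IsMonHom`
witness carried by `f` is irrelevant. [cite: Tate1997FiniteFlatGroupSchemes, §(3.8) p. 145] -/
theorem cartierDualMap_of_eq_one (hf : f = 1) : cartierDualMap f = 1 := by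
  apply coord_injective
  rw [← Category.id_comp (cartierDualMap f), coord_comp_cartierDualMap, coord_id_cartierDual]
  have h1 : coord (1 : cartierDual G₂ ⟶ cartierDual G₁) = (1 : WithConv (DualAlg G₁ →ₐ[R] Alg (cartierDual G₂))).ofConv :=
    coord_one_eq R (DualAlg G₁) (T := cartierDual G₂)
  rw [h1, AlgHom.convOne_def, WithConv.ofConv_toConv]
  apply AlgHom.ext
  intro ν
  change (algCartierDualEquiv G₂).symm (DualAlg.transpose f ν) = algebraMap R (Alg (cartierDual G₂)) (WithConv.ofConv ν 1)
  rw [DualAlg.transpose_apply_of_eq_one f hf, AlgEquiv.commutes]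

end One

end AffineGroupScheme

end Literature.AlgebraicGeometry.GroupSchemes

end
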